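import Literature.NumberTheory.EllipticCurves.PadicWeierstrassZetaProofs
import Literature.NumberTheory.EllipticCurves.FormalGroupMultiplicationUniversalProofs
import HarnessLib

/-!
# `[n](-t) = -[n](t)` on a short Weierstrass model, and even/odd series as series in `t²`
# (Silverman AEC IV; Blakestad–Grant 2023, §2 — proofs only)

Trunk T-NT-EC (Literature/NumberTheory/EllipticCurves). Blakestad–Grant work on
`y² = x³ + A₄x + A₆` with ODD `t`-expansions throughout (`t' = ∑ ρₙ t^{2n-1}`, `σ`, `d(t)` of
degree `p - 1`…). This file supplies the parity of the multiplication maps and the passage to the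
variable `q = t²` used to halve degrees (the kernel polynomial `D` has degree `(p-1)/2`):

* `eq_of_formalInvDiff_subst_mul_derivative_eq` — **uniqueness for `ω(f)·f' = ω(g)·g'`** with
  `f(0) = g(0) = 0` and equal linear terms, over an additively torsion-free ring (coefficient of
  `zᵏ⁻¹`: `k·(gₖ - fₖ) = 0`; substitution is a congruence mod `zᵏ`, `coeff_subst_eq_of_coeff_eq`);
* **`rescale_neg_one_formalMul`** — `[n](-t) = -[n](t)` for `a₁ = a₃ = 0` (both solve
  `ω(f)f' = nω`, `ω` even: `rescale_neg_one_formalInvDiff`), with the small calculus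
  `derivative_rescale`, `subst_neg_eq_rescale_subst`;
* `eq_expand_two_of_rescale_neg_one_eq_self` / `eq_X_mul_expand_two_of_rescale_neg_one_eq_neg` —
  an even series is `ξ(z²)`, an odd one is `z·m(z²)` (Mathlib `PowerSeries.expand 2`).

## Sources

* J. H. Silverman, *AEC* 2nd ed. (2009), IV.2.3, IV.4.3 (`ω∘[n]·[n]' = nω`), IV.5.
  [SilvermanAEC2009]
* C. Blakestad, D. Grant, J. Number Theory 249 (2023), §2.1–2.3. [BlakestadGrant2023]

Pure proof file: no definitions, no named facts.
-/

noncomputable section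

open PowerSeries Literature.NumberTheory.EllipticCurves

namespace Literature.NumberTheory.EllipticCurves

variable {R : Type*} [CommRing R]

/-- `(f(az))' = a·f'(az)`. [folklore] -/
theorem derivative_rescale (a : R) (f : R⟦X⟧) : d⁄dX R (rescale a f) = a • rescale a (d⁄dX R f) := by
  ext n
  rw [coeff_derivative, coeff_rescale, map_smul, coeff_rescale, coeff_derivative, smul_eq_mul, pow_succ]
  ring

/-- `(f ∘ h)(az) = f(h(az))` (a private copy of `rescale_subst` of
`PadicSigmaFunctionalEquationProofs`, to keep the imports small). [folklore] -/
private theorem rescale_subst_aux (a : R) {h : R⟦X⟧} (hh : constantCoeff h = 0) (f : R⟦X⟧) :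
    rescale a (f.subst h) = f.subst (rescale a h) := by
  have hX : HasSubst (a • (X : R⟦X⟧)) := HasSubst.smul_X a ()
  rw [rescale_eq_subst, rescale_eq_subst, subst_comp_subst_apply (HasSubst.of_constantCoeff_zero' hh) hX]

/-- `f(-g) = f⁻(g)` with `f⁻(z) = f(-z)`. [folklore] -/
theorem subst_neg_eq_rescale_subst {g : R⟦X⟧} (hg : constantCoeff g = 0) (f : R⟦X⟧) :
    f.subst (-g) = (rescale (-1 : R) f).subst g := by
  have hgs : HasSubst g := HasSubst.of_constantCoeff_zero' hg
  have hnX : HasSubst (-(X : R⟦X⟧)) := HasSubst.of_constantCoeff_zero' (by simp)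
  rw [← subst_neg_X_eq_rescale, subst_comp_subst_apply hnX hgs, ← coe_substAlgHom hgs, map_neg, coe_substAlgHom,
    subst_X hgs]

/-- `Xᵏ ∣ gᵐ - fᵐ` when `Xᵏ ∣ g - f`. [folklore] -/
theorem X_pow_dvd_pow_sub_pow {f g : R⟦X⟧} {k : ℕ} (h : (X : R⟦X⟧) ^ k ∣ g - f) (m : ℕ) :
    (X : R⟦X⟧) ^ k ∣ g ^ m - f ^ m := by
  induction m with
  | zero => simp
  | succ m ih =>
    have e : g ^ (m + 1) - f ^ (m + 1) = g ^ m * (g - f) + (g ^ m - f ^ m) * f := by ring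
    rw [e]
    exact dvd_add (dvd_mul_of_dvd_right h _) (dvd_mul_of_dvd_left ih _)

/-- Substitution is a congruence modulo `Xᵏ`: if `g ≡ f (mod zᵏ)` then `F(g) ≡ F(f) (mod zᵏ)`.
[folklore] -/
theorem coeff_subst_eq_of_coeff_eq {f g : R⟦X⟧} (hf : constantCoeff f = 0) (hg : constantCoeff g = 0) {k : ℕ}
    (hfg : ∀ i < k, coeff i g = coeff i f) (F : R⟦X⟧) {i : ℕ} (hi : i < k) :
    coeff i (F.subst g) = coeff i (F.subst f) := by
  have hdvd : (X : R⟦X⟧) ^ k ∣ g - f := by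
    rw [X_pow_dvd_iff]
    intro m hm
    rw [map_sub, hfg m hm, sub_self]
  rw [coeff_subst' (HasSubst.of_constantCoeff_zero' hg), coeff_subst' (HasSubst.of_constantCoeff_zero' hf)]
  refine finsum_congr fun d => ?_
  congr 1
  have h := (X_pow_dvd_iff.mp (X_pow_dvd_pow_sub_pow hdvd d)) i hi
  rwa [map_sub, sub_eq_zero] at h

/-- **An even series is a series in `z²`**: if `f(-z) = f(z)` over an additively torsion-free ring
then `f(z) = ξ(z²)` with `ξ = ∑ f₂ₖ qᵏ`. [folklore] -/
theorem eq_expand_two_of_rescale_neg_one_eq_self [IsAddTorsionFree R] {f : R⟦X⟧} (h : rescale (-1 : R) f = f) :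
    f = expand 2 two_ne_zero (PowerSeries.mk fun k => coeff (2 * k) f) := by
  ext m
  rw [coeff_expand]
  split_ifs with hm
  · obtain ⟨k, rfl⟩ := hm
    rw [coeff_mk, Nat.mul_div_cancel_left _ two_pos]
  · exact coeff_eq_zero_of_rescale_neg_one_eq_self h (Nat.odd_iff.mpr (Nat.two_dvd_ne_zero.mp hm))

/-- **An odd series is `z` times a series in `z²`**: if `f(-z) = -f(z)` over an additively
torsion-free ring then `f(z) = z·m(z²)` with `m = ∑ f₂ₖ₊₁ qᵏ`. [folklore] -/
theorem eq_X_mul_expand_two_of_rescale_neg_one_eq_neg [IsAddTorsionFree R] {f : R⟦X⟧} (h : rescale (-1 : R) f = -f) :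
    f = X * expand 2 two_ne_zero (PowerSeries.mk fun k => coeff (2 * k + 1) f) := by
  ext m
  rcases Nat.eq_zero_or_pos m with rfl | hm
  · rw [coeff_zero_X_mul]
    exact coeff_eq_zero_of_rescale_neg_one_eq_neg h Even.zero
  · obtain ⟨m, rfl⟩ : ∃ m', m = m' + 1 := ⟨m - 1, by omega⟩
    rw [coeff_succ_X_mul, coeff_expand]
    split_ifs with hm2
    · obtain ⟨k, rfl⟩ := hm2
      rw [coeff_mk, Nat.mul_div_cancel_left _ two_pos]
    · exact coeff_eq_zero_of_rescale_neg_one_eq_neg h (by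
        rcases Nat.even_or_odd m with he | ho
        · exact absurd he.two_dvd hm2
        · exact ho.add_one)

end Literature.NumberTheory.EllipticCurves

namespace WeierstrassCurve

variable {R : Type*} [CommRing R] (W : WeierstrassCurve R)

/-- **Uniqueness for the logarithmic differential equation** `ω(f)·f' = ω(g)·g'`
(`ω = formalInvDiff`): over an additively torsion-free ring two solutions with `f(0) = g(0) = 0`
and the same linear term coincide (comparing the coefficient of `zᵏ⁻¹` gives `k·(gₖ - fₖ) = 0`).
[Silverman AEC IV.4–5 (uniqueness of the formal logarithm / of `[n]`)] [folklore] -/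
theorem eq_of_formalInvDiff_subst_mul_derivative_eq [IsAddTorsionFree R] {f g : R⟦X⟧}
    (hf : constantCoeff f = 0) (hg : constantCoeff g = 0) (h1 : coeff 1 f = coeff 1 g)
    (hfg : W.formalInvDiff.subst f * d⁄dX R f = W.formalInvDiff.subst g * d⁄dX R g) : f = g := by
  ext k
  induction k using Nat.strong_induction_on with
  | _ k IH =>
    rcases Nat.lt_or_ge k 2 with hk | hk
    · interval_cases k
      · rw [coeff_zero_eq_constantCoeff, hf, hg]
      · exact h1
    · -- `g ≡ f (mod zᵏ)`
      have hlow : ∀ i < k, coeff i g = coeff i f := fun i hi => (IH i hi).symm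
      have hW : ∀ i < k, coeff i (W.formalInvDiff.subst g) = coeff i (W.formalInvDiff.subst f) :=
        fun i hi => coeff_subst_eq_of_coeff_eq hf hg hlow _ hi
      -- compare the coefficient of `zᵏ⁻¹`
      have e := congrArg (coeff (k - 1)) hfg
      rw [coeff_mul, coeff_mul] at e
      -- split both sums at the term `(0, k-1)`
      have hmem : ((0, k - 1) : ℕ × ℕ) ∈ Finset.antidiagonal (k - 1) := Finset.mem_antidiagonal.mpr (by simp)
      have hsplit : ∀ (F H : R⟦X⟧), ∑ x ∈ Finset.antidiagonal (k - 1), coeff x.1 F * coeff x.2 H =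
          coeff 0 F * coeff (k - 1) H + ∑ x ∈ (Finset.antidiagonal (k - 1)).erase (0, k - 1), coeff x.1 F * coeff x.2 H := by
        intro F H
        rw [← Finset.add_sum_erase _ (fun x : ℕ × ℕ => coeff x.1 F * coeff x.2 H) hmem]
      rw [hsplit, hsplit] at e
      have hrest : ∑ x ∈ (Finset.antidiagonal (k - 1)).erase (0, k - 1), coeff x.1 (W.formalInvDiff.subst f) *
          coeff x.2 (d⁄dX R f) = ∑ x ∈ (Finset.antidiagonal (k - 1)).erase (0, k - 1),
          coeff x.1 (W.formalInvDiff.subst g) * coeff x.2 (d⁄dX R g) := by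
        refine Finset.sum_congr rfl fun x hx => ?_
        have hx' := Finset.mem_erase.mp hx
        have hsum : x.1 + x.2 = k - 1 := Finset.mem_antidiagonal.mp hx'.2
        have hx2 : x.2 < k - 1 := by
          rcases Nat.eq_or_lt_of_le (show x.2 ≤ k - 1 by omega) with h | h
          · exfalso
            apply hx'.1
            have h0 : x.1 = 0 := by omega
            exact Prod.ext h0 h
          · exact h
        rw [hW x.1 (by omega), coeff_derivative, coeff_derivative, hlow (x.2 + 1) (by omega)]
      rw [hrest, add_left_inj] at e
      have hW0 : ∀ h : R⟦X⟧, constantCoeff h = 0 → coeff 0 (W.formalInvDiff.subst h) = 1 := by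
        intro h hh
        rw [coeff_zero_eq_constantCoeff, constantCoeff_subst_eq_constantCoeff hh, W.constantCoeff_formalInvDiff]
      have hcast : ((k - 1 : ℕ) : R) + 1 = (k : R) := by
        rw [← Nat.cast_succ, Nat.succ_eq_add_one, Nat.sub_add_cancel (by omega : 1 ≤ k)]
      rw [hW0 f hf, hW0 g hg, one_mul, one_mul, coeff_derivative, coeff_derivative, Nat.sub_add_cancel (by omega : 1 ≤ k),
        hcast] at e
      have e2 : k • (coeff k g - coeff k f) = 0 := by
        rw [nsmul_eq_mul]
        linear_combination (-1 : R) * e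
      have e3 := (nsmul_eq_zero_iff.mp e2).resolve_right (by omega : k ≠ 0)
      exact (sub_eq_zero.mp e3).symm

/-- **`[n](-t) = -[n](t)`** on a model with `a₁ = a₃ = 0` over an additively torsion-free ring: both
sides solve `ω(f)·f' = n·ω`, `f = nt + O(t²)` (`ω` is even), so they agree by uniqueness.
[Silverman AEC IV.2.3, IV.4.3; Blakestad–Grant 2023, §2 (odd `t`-expansions on `y² = x³ + A₄x + A₆`)]
[cite: SilvermanAEC2009, IV.2.3] -/
theorem rescale_neg_one_formalMul [W.IsCharNeTwoNF] [IsAddTorsionFree R] (n : ℕ) :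
    rescale (-1 : R) (W.formalMul n) = -W.formalMul n := by
  set f := W.formalMul n with hf
  have hf0 : constantCoeff f = 0 := W.constantCoeff_formalMul n
  have hr0 : constantCoeff (rescale (-1 : R) f) = 0 := by
    rw [← coeff_zero_eq_constantCoeff_apply, coeff_rescale, pow_zero, one_mul, coeff_zero_eq_constantCoeff_apply, hf0]
  set g := -rescale (-1 : R) f with hg
  have hg0 : constantCoeff g = 0 := by rw [hg, map_neg, hr0, neg_zero]
  have h1 : coeff 1 f = coeff 1 g := by
    rw [hg, map_neg, coeff_rescale, pow_one, neg_one_mul, neg_neg]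
  have hF : W.formalInvDiff.subst f * d⁄dX R f = n • W.formalInvDiff := W.formalInvDiff_subst_formalMul_mul_derivative' n
  have hG : W.formalInvDiff.subst g * d⁄dX R g = n • W.formalInvDiff := by
    have hWg : W.formalInvDiff.subst g = rescale (-1 : R) (W.formalInvDiff.subst f) := by
      rw [hg, subst_neg_eq_rescale_subst hr0, W.rescale_neg_one_formalInvDiff, rescale_subst_aux (-1 : R) hf0]
    have hg' : d⁄dX R g = rescale (-1 : R) (d⁄dX R f) := by
      rw [hg, map_neg, derivative_rescale, neg_one_smul, neg_neg]
    rw [hWg, hg', ← map_mul, hF, map_nsmul, W.rescale_neg_one_formalInvDiff]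
  have hfg := W.eq_of_formalInvDiff_subst_mul_derivative_eq hf0 hg0 h1 (by rw [hF, hG])
  -- `f = -f(-z)` ⇒ `f(-z) = -f`
  have := congrArg Neg.neg hfg
  rw [hg, neg_neg] at this
  exact this.symm

end WeierstrassCurve
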